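import Mathlib
import Summits.ValiantsHypothesis.ValiantsHypothesis.Theses.RigidityForcesSymmetry
import Summits.ValiantsHypothesis.ValiantsHypothesis.Theorems.RigidityForcesSymmetryRigidityForcesTorus
import Summits.ValiantsHypothesis.ValiantsHypothesis.Theorems.RigidityForcesSymmetryRigidMinimalReprRefutation

/-!
# Route RigidityForcesSymmetry — crux `RigidAtThree` (stmt-ValiantsHypothesis-4165) is FALSE

`RigidAtThree` is the `n = 3` instance of `RigidMinimalRepr`: some `7 × 7` affine determinantal representation
of `per_3` has a locally open `GL_7 × GL_7`-orbit.  Since `7 = 2^3 - 1` is already the tight size, the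
refutation of `RigidMinimalRepr` applies verbatim, without any appeal to minimality: a locally open orbit makes
the pencil two-sided-torus-equivariant (`rigidityForcesTorus_proof`, stmt-4166), and in the tight case the
Koszul row twist of the graded normal form leaves the orbit inside every neighbourhood
(`RigidityForcesSymmetryRigidMinimalRepr.stub_tightNotRigid`).
-/

section buildfix_record -- buildfix lane 2026-08-19: re-created record(s) of dropped route item(s), see docstring(s)
open scoped BigOperators Topology Manifold Classical MeasureTheory ProbabilityTheory Matrix InnerProductSpace ComplexConjugate ContinuousMap
open Filter Set Function TopologicalSpace MeasureTheory
open Literature.PNP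
namespace Summit.ValiantsHypothesis.ValiantsHypothesis.Theses.RigidityForcesSymmetry

/-- **Record of the dropped route item `RigidAtThree`** = stmt-ValiantsHypothesis-4165 (ledger signature verbatim; NOT a route
item): route RigidityForcesSymmetry rev 3 (2026-08-17T10:50Z) dropped the refuted crux `RigidAtThree` (refuted by `not_RigidAtThree` below; item closed `refuted`). The declaration `Summit.ValiantsHypothesis.ValiantsHypothesis.Theses.RigidityForcesSymmetry.RigidAtThree`
therefore no longer exists in the route file and this accepted module stopped elaborating (stale olean;
buildfix lane 2026-08-19). Re-created here under its original name so the result keeps building; the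
statement of every previously accepted declaration in this file is unchanged. -/
def RigidAtThree : Prop :=
  ∃ (Λ : Matrix (Fin 7) (Fin 7) ℂ) (A : Fin 3 × Fin 3 → Matrix (Fin 7) (Fin 7) ℂ), (Λ.map MvPolynomial.C + ∑ v, (MvPolynomial.X v : MvPolynomial (Fin 3 × Fin 3) ℂ) • (A v).map MvPolynomial.C).det = Literature.Computability.AlgebraicComplexity.perPoly (Fin 3) ℂ ∧ ∃ U ∈ nhds (Λ, A), ∀ p ∈ U, (p.1.map MvPolynomial.C + ∑ v, (MvPolynomial.X v : MvPolynomial (Fin 3 × Fin 3) ℂ) • (p.2 v).map MvPolynomial.C).det = Literature.Computability.AlgebraicComplexity.perPoly (Fin 3) ℂ → ∃ g h : GL (Fin 7) ℂ, p.1 = (g : Matrix (Fin 7) (Fin 7) ℂ) * Λ * ((h⁻¹ : GL (Fin 7) ℂ) : Matrix (Fin 7) (Fin 7) ℂ) ∧ ∀ v, p.2 v = (g : Matrix (Fin 7) (Fin 7) ℂ) * A v * ((h⁻¹ : GL (Fin 7) ℂ) : Matrix (Fin 7) (Fin 7) ℂ)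

end Summit.ValiantsHypothesis.ValiantsHypothesis.Theses.RigidityForcesSymmetry
end buildfix_record


open MvPolynomial
open Literature.Computability.AlgebraicComplexity
open Summit.ValiantsHypothesis.ValiantsHypothesis.Theses.RigidityForcesSymmetry

-- the mandated summit-side namespace repeats a component by design (single-problem summit)
set_option linter.dupNamespace false

namespace Summit.ValiantsHypothesis.ValiantsHypothesis.Theorems.RigidityForcesSymmetryRigidAtThree

/-- **`RigidAtThree` is false**: no `7 × 7` affine determinantal representation of `per_3` has a locally
open `GL_7 × GL_7`-orbit in `{det = per_3}` (tight case `7 = 2^3 - 1` of the refutation of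
`RigidMinimalRepr`). -/
theorem not_RigidAtThree : ¬ RigidAtThree := by
  rintro ⟨Λ, A, hdet, hU⟩
  have hEq := rigidityForcesTorus_proof 3 le_rfl 7 Λ A hdet hU
  exact RigidityForcesSymmetryRigidMinimalRepr.stub_tightNotRigid (m := 3) (n := 7) le_rfl (by norm_num)
    Λ A hdet hEq hU

end Summit.ValiantsHypothesis.ValiantsHypothesis.Theorems.RigidityForcesSymmetryRigidAtThree
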